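import Summits.AtomisticToContinuum.BoseEinsteinCondensation.Theorems.BECConjugateDominationPositiveMinimiserDefs
import Literature.MathematicalPhysics.QuantumManyBody.PeriodicBoseGasImpurity
import Mathlib.Analysis.Calculus.ParametricIntegral
import Mathlib.Analysis.Calculus.ContDiff.Basic
import HarnessLib

/-!
# Route `BECConjugateDomination`, support item `PositiveMinimiser` — the free heat operator, I

Infrastructure for the regularity (`C³`) of the Feynman–Kac ground state of the periodic
`N`-body Hamiltonian (item stmt-AtomisticToContinuum-11787): the **free heat operator**
`(P_t f)(X) = E[f(X + √2 b_t)] = ∫ p(2t; Z) f(X + Z) dZ` acting on functions with values in a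
real Banach space `E` (we need `E = ℝ` and the iterated derivative spaces
`Config N →L[ℝ] ⋯ →L[ℝ] ℝ`). This file (objects from the `…PositiveMinimiserDefs` file): the value at `t = 0`, sup bound, linearity,
periodicity, continuity in time, the Gaussian DENSITY form
`P_t f (X) = ∫ gaussKer t Z • f (X + Z) dZ = ∫ gaussKer t (Y - X) • f Y dY` (`t > 0`), and the
identification with the tree's periodic Feynman–Kac functional at zero potential,
`pfkReal 0 L t f = P_t f` (real `f`; the weight is one by the Literature lemma
`periodizedPotential_zero`), which transfers the semigroup law.

All statements are standard facts about the Gaussian semigroup [folklore].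
-/

noncomputable section

namespace Summit.AtomisticToContinuum.BoseEinsteinCondensation.Theorems.PositiveMinimiser

open MeasureTheory ProbabilityTheory Filter Set
open scoped ENNReal NNReal Topology
open Literature.MathematicalPhysics.QuantumManyBody.BoseGas
open Literature.Probability.Process (brownian)

variable {N : ℕ} {E : Type} [NormedAddCommGroup E] [NormedSpace ℝ E]

/-! ### The free heat operator -/

/-- The sample map `ω ↦ X + √2 b_t(ω)` is measurable. [folklore] -/
@[fun_prop]
theorem measurable_add_displacement (X : Config N) (t : ℝ≥0) :
    Measurable fun ω : PathSpace N => X + displacement t ω :=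
  measurable_const.add (measurable_displacement t)

omit [NormedSpace ℝ E] in
/-- The integrand of `P_t f` is a.e. strongly measurable for continuous `f`. [folklore] -/
theorem aestronglyMeasurable_comp_add_displacement {f : Config N → E} (hf : Continuous f)
    (X : Config N) (t : ℝ≥0) :
    AEStronglyMeasurable (fun ω : PathSpace N => f (X + displacement t ω)) (wienerPaths N) :=
  hf.comp_aestronglyMeasurable (measurable_add_displacement X t).aestronglyMeasurable

/-- `P_0 = id`. [folklore] -/
@[simp] theorem heatOp_zero [CompleteSpace E] (f : Config N → E) (X : Config N) :
    heatOp 0 f X = f X := by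
  simp only [heatOp, displacement_zero, add_zero]
  rw [integral_const]
  simp

/-- `heatOpR s = id` for `s ≤ 0`. [folklore] -/
theorem heatOpR_of_nonpos [CompleteSpace E] {s : ℝ} (hs : s ≤ 0) (f : Config N → E) (X : Config N) :
    heatOpR s f X = f X := by
  rw [heatOpR, Real.toNNReal_of_nonpos hs, heatOp_zero]

/-- **Sup bound**: `‖P_t f (X)‖ ≤ M` if `‖f‖ ≤ M` everywhere. [folklore] -/
theorem norm_heatOp_le {f : Config N → E} {M : ℝ} (hM : ∀ Y, ‖f Y‖ ≤ M) (t : ℝ≥0)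
    (X : Config N) : ‖heatOp t f X‖ ≤ M := by
  have hM0 : 0 ≤ M := (norm_nonneg _).trans (hM 0)
  refine (norm_integral_le_integral_norm _).trans ?_
  refine (integral_mono_of_nonneg (Eventually.of_forall fun _ => norm_nonneg _)
    (integrable_const M) (Eventually.of_forall fun ω => hM _)).trans ?_
  simp

omit [NormedSpace ℝ E] in
/-- The integrand of `P_t f` is integrable for continuous bounded `f`. [folklore] -/
theorem integrable_comp_add_displacement {f : Config N → E} (hf : Continuous f) {M : ℝ}
    (hM : ∀ Y, ‖f Y‖ ≤ M) (X : Config N) (t : ℝ≥0) :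
    Integrable (fun ω : PathSpace N => f (X + displacement t ω)) (wienerPaths N) :=
  Integrable.of_bound (aestronglyMeasurable_comp_add_displacement hf X t) M
    (Eventually.of_forall fun _ => hM _)

/-- **`X ↦ P_t f (X)` is continuous** for continuous bounded `f` (dominated convergence).
[folklore] -/
theorem continuous_heatOp {f : Config N → E} (hf : Continuous f) {M : ℝ}
    (hM : ∀ Y, ‖f Y‖ ≤ M) (t : ℝ≥0) : Continuous (heatOp t f) := by
  refine continuous_of_dominated (fun X => aestronglyMeasurable_comp_add_displacement hf X t)
    (fun X => Eventually.of_forall fun _ => hM _) (integrable_const M)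
    (Eventually.of_forall fun ω => ?_)
  exact hf.comp (continuous_id.add continuous_const)

/-! ### Continuity in time -/

/-- **`t ↦ P_t f (X)` is continuous on `[0, ∞)`** for continuous bounded `f` (dominated
convergence along the continuous Brownian paths). [folklore] -/
theorem continuous_heatOp_time {f : Config N → E} (hf : Continuous f) {M : ℝ}
    (hM : ∀ Y, ‖f Y‖ ≤ M) (X : Config N) : Continuous fun t : ℝ≥0 => heatOp t f X := by
  refine continuous_of_dominated (fun t => aestronglyMeasurable_comp_add_displacement hf X t)
    (fun t => Eventually.of_forall fun _ => hM _) (integrable_const M)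
    (Eventually.of_forall fun ω => ?_)
  exact hf.comp (continuous_const.add (continuous_displacement ω))

/-- `s ↦ heatOpR s f X` is continuous on `ℝ` for continuous bounded `f`. [folklore] -/
theorem continuous_heatOpR {f : Config N → E} (hf : Continuous f) {M : ℝ}
    (hM : ∀ Y, ‖f Y‖ ≤ M) (X : Config N) : Continuous fun s : ℝ => heatOpR s f X :=
  (continuous_heatOp_time hf hM X).comp continuous_real_toNNReal

/-! ### The Gaussian kernel and the density form -/

omit [NormedSpace ℝ E] in
/-- The kernel is nonnegative. [folklore] -/
theorem gaussKer_nonneg (t : ℝ≥0) (Z : Config N) : 0 ≤ gaussKer t Z :=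
  Finset.prod_nonneg fun _ _ => Finset.prod_nonneg fun _ _ => gaussianPDFReal_nonneg _ _ _

/-- The `ℝ≥0∞` product density of the tree is `ofReal` of the real kernel. [folklore] -/
theorem gaussDensity_eq_ofReal_gaussKer (t : ℝ≥0) (Z : Config N) :
    (∏ i, ∏ k, gaussianPDF 0 (2 * t) (Z i k)) = ENNReal.ofReal (gaussKer t Z) := by
  rw [gaussKer, ENNReal.ofReal_prod_of_nonneg (fun i _ => Finset.prod_nonneg fun k _ =>
    gaussianPDFReal_nonneg _ _ _)]
  refine Finset.prod_congr rfl fun i _ => ?_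
  rw [ENNReal.ofReal_prod_of_nonneg (fun k _ => gaussianPDFReal_nonneg _ _ _)]
  rfl

/-- The kernel is measurable. [folklore] -/
@[fun_prop]
theorem measurable_gaussKer (t : ℝ≥0) : Measurable (gaussKer (N := N) t) := by
  refine Finset.measurable_prod _ fun i _ => Finset.measurable_prod _ fun k _ => ?_
  exact (measurable_gaussianPDFReal _ _).comp ((measurable_pi_apply k).comp
    ((WithLp.measurable_ofLp 2 _).comp (measurable_pi_apply i)))

/-- The kernel is continuous. [folklore] -/
@[fun_prop]
theorem continuous_gaussKer (t : ℝ≥0) : Continuous (gaussKer (N := N) t) := by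
  refine continuous_finsetProd _ fun i _ => continuous_finsetProd _ fun k _ => ?_
  have h1 : Continuous (gaussianPDFReal 0 (2 * t)) := by
    unfold gaussianPDFReal; fun_prop
  exact h1.comp ((continuous_apply k).comp ((PiLp.continuous_ofLp 2 _).comp (continuous_apply i)))

/-- The law of the displacement at `t > 0` is `gaussKer t · Lebesgue`. [folklore] -/
theorem map_displacement_eq_withDensity_gaussKer {t : ℝ≥0} (ht : t ≠ 0) :
    (wienerPaths N).map (displacement t) =
      (volume : Measure (Config N)).withDensity fun Z => ENNReal.ofReal (gaussKer t Z) := by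
  rw [map_displacement_eq ht]
  congr 1
  funext Z
  exact gaussDensity_eq_ofReal_gaussKer t Z

/-- **Expectations of the displacement are Gaussian integrals** (Bochner form, any Banach
space): `E[F(√2 b_t)] = ∫ gaussKer t Z • F Z dZ` for `t > 0`. [folklore] -/
theorem integral_displacement_eq_integral_gaussKer_smul {t : ℝ≥0} (ht : t ≠ 0)
    {F : Config N → E} (hF : AEStronglyMeasurable F volume) :
    ∫ ω, F (displacement t ω) ∂wienerPaths N = ∫ Z, gaussKer t Z • F Z := by
  have hac : (wienerPaths N).map (displacement t) ≪ volume := by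
    rw [map_displacement_eq_withDensity_gaussKer ht]; exact withDensity_absolutelyContinuous _ _
  have hF' : AEStronglyMeasurable F ((wienerPaths N).map (displacement t)) := hF.mono_ac hac
  rw [← integral_map (measurable_displacement t).aemeasurable hF',
    map_displacement_eq_withDensity_gaussKer ht,
    integral_withDensity_eq_integral_toReal_smul (measurable_gaussKer t).ennreal_ofReal
      (Eventually.of_forall fun Z => ENNReal.ofReal_lt_top)]
  refine integral_congr_ae (Eventually.of_forall fun Z => ?_)
  simp only
  rw [ENNReal.toReal_ofReal (gaussKer_nonneg t Z)]

/-- **Density form of the heat operator, centred**: `P_t f (X) = ∫ gaussKer t Z • f (X + Z) dZ`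
(`t > 0`, continuous `f`). [folklore] -/
theorem heatOp_eq_integral_gaussKer_smul {t : ℝ≥0} (ht : t ≠ 0) {f : Config N → E}
    (hf : Continuous f) (X : Config N) :
    heatOp t f X = ∫ Z, gaussKer t Z • f (X + Z) := by
  rw [heatOp]
  exact integral_displacement_eq_integral_gaussKer_smul ht
    ((hf.comp (continuous_const.add continuous_id)).aestronglyMeasurable)

/-- **Density form of the heat operator**: `P_t f (X) = ∫ gaussKer t (Y - X) • f Y dY`
(`t > 0`, continuous `f`; translation invariance of Lebesgue measure). [folklore] -/
theorem heatOp_eq_integral_gaussKer_sub_smul {t : ℝ≥0} (ht : t ≠ 0) {f : Config N → E}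
    (hf : Continuous f) (X : Config N) :
    heatOp t f X = ∫ Y, gaussKer t (Y - X) • f Y := by
  rw [heatOp_eq_integral_gaussKer_smul ht hf X,
    ← integral_add_left_eq_self (fun Y => gaussKer t (Y - X) • f Y) X]
  refine integral_congr_ae (Eventually.of_forall fun Z => ?_)
  simp only [add_sub_cancel_left]

/-! ### Identification with the periodic Feynman–Kac functional at zero potential -/

/-- **At zero potential the periodic Feynman–Kac functional is the free heat operator**:
`pfkReal 0 L s f = heatOpR s f` (real observables). [folklore] -/
theorem pfkReal_zero_eq_heatOpR (L s : ℝ) (f : Config N → ℝ) (X : Config N) :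
    pfkReal 0 L s f X = heatOpR s f X := by
  -- the periodic Feynman–Kac weight of the zero potential is one (`periodizedPotential_zero`)
  have hw : ∀ ω : PathSpace N, periodicFKWeight (N := N) 0 L s X ω = 1 := fun ω => by
    simp [periodicFKWeight, periodicPathAction, periodicInteraction]
  simp only [pfkReal, hw, ENNReal.toReal_one, one_mul, heatOpR, heatOp, worldLine_eq_add_displacement]

/-- A bounded real function has finite squared mass on the cell. [folklore] -/
theorem setLIntegral_cellN_enorm_sq_ne_top_of_bound (L : ℝ) {f : Config N → ℝ} {M : ℝ}
    (hM : ∀ Y, |f Y| ≤ M) : ∫⁻ Y in cellN N L, ‖f Y‖ₑ ^ (2 : ℝ) ≠ ⊤ := by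
  have hle : ∀ Y, ‖f Y‖ₑ ^ (2 : ℝ) ≤ ENNReal.ofReal M ^ (2 : ℝ) := fun Y => by
    refine ENNReal.rpow_le_rpow ?_ (by norm_num)
    rw [Real.enorm_eq_ofReal_abs]
    exact ENNReal.ofReal_le_ofReal (hM Y)
  refine ne_top_of_le_ne_top ?_ (lintegral_mono fun Y => hle Y)
  rw [setLIntegral_const]
  exact ENNReal.mul_ne_top (ENNReal.rpow_ne_top_of_nonneg (by norm_num) ENNReal.ofReal_ne_top)
    (volume_cellN_ne_top N L)

/-- **Semigroup law for the free heat operator on real periodic data**: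
`P_{s+t} f = P_s (P_t f)` for continuous `Lℤ³`-periodic real `f` (`L > 0`; transferred from
`pfkReal_add_time` at zero potential). [folklore] -/
theorem heatOp_add_time {L : ℝ} (hL : 0 < L) {f : Config N → ℝ} (hf : Continuous f)
    (hper : ∀ (Y : Config N) (i : Fin N) (k : Fin 3),
      f (Y + Pi.single i (EuclideanSpace.single k L)) = f Y)
    (s t : ℝ≥0) (X : Config N) : heatOp (s + t) f X = heatOp s (heatOp t f) X := by
  rcases eq_or_ne s 0 with rfl | hs
  · simp
  rcases eq_or_ne t 0 with rfl | ht
  · simp only [add_zero]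
    congr 1
    funext Y
    rw [heatOp_zero]
  have hs' : (0 : ℝ) < s := lt_of_le_of_ne s.coe_nonneg (fun h => hs (by exact_mod_cast h.symm))
  have ht' : (0 : ℝ) < t := lt_of_le_of_ne t.coe_nonneg (fun h => ht (by exact_mod_cast h.symm))
  obtain ⟨M, -, hM⟩ := exists_bound_of_continuous_periodic hL hf hper
  have hf2 : ∫⁻ Y in cellN N L, ‖f Y‖ₑ ^ (2 : ℝ) ≠ ⊤ := setLIntegral_cellN_enorm_sq_ne_top_of_bound L hM
  have key := pfkReal_add_time (v := 0) measurable_zero hL hs' ht' hf.measurable hper hf2 X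
  have e1 : pfkReal 0 L ((s : ℝ) + t) f X = heatOp (s + t) f X := by
    rw [pfkReal_zero_eq_heatOpR, show ((s : ℝ) + t) = ((s + t : ℝ≥0) : ℝ) by push_cast; ring,
      heatOpR_coe]
  have e2 : pfkReal 0 L t f = heatOp t f := by
    funext Y; rw [pfkReal_zero_eq_heatOpR, heatOpR_coe]
  rw [← e1, key, e2, pfkReal_zero_eq_heatOpR, heatOpR_coe]

end Summit.AtomisticToContinuum.BoseEinsteinCondensation.Theorems.PositiveMinimiser

end
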